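import Summits.QuantumFields.YangMills.Theses.LangevinControlUV
import Summits.QuantumFields.YangMills.Theorems.ParabolicTrajectoryLatticeGapOnTrajectoryTransferFromOSGapSlack
import Literature.MathematicalPhysics.QuantumFieldTheory.MassGapFromLatticeClustering

/-!
# Lead c1's restatement addendum for crux `GapToContinuum` (stmt-QuantumFields-8896): re-type R4

Evidence for the tenure planner of `route-QuantumFields-LangevinControlUV` (and of `OneCertifiedCube`,
whose re-typed sibling stmt-QuantumFields-16126 has the same defect D3), complementing seat -0's
`Restatement.lean` (R1 = `sch.HasCSClustering` hypothesis, closed by the tree theorem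
`IsYangMillsFor.hasMassGap_of_hasCSClustering`; R2 = OS legs emitting it; R3 = sup-norm re-type with
growth conditions, prose only).  This file ELABORATES (rc 0, 0 sorries) and records a SECOND closable
re-type that keeps genuinely lattice-side content in the crux, in the currency the sibling crux
`LatticeGapOnTrajectory` (stmt-QuantumFields-10523, route ParabolicTrajectory) has already engineered and
LANDED in the tree (`Theorems/ParabolicTrajectoryLatticeGapOnTrajectoryTransferFromOSGap{,Slack}.lean`,
sorry-free):

* R4 `GapToContinuumOS` — hypothesis = the lattice mass gap in Osterwalder–Schrader currency on the
  scheme's OWN tori with an `a_k`-superpolynomially small thermal slack (`TorusOSGapSlack r sch Δ ε`: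
  eventually in `k`, for EVERY bounded measurable `X` of the positive half-torus of time width `w` and
  every shift `m` with `m + 2w ≤ L_k`, `‖corr_k(ΘX̄, τ_m X)‖ ≤ Re osVar_k(X) · e^{−Δ a_k m} + ε_k ‖X‖∞²`),
  for `M`-adic spacings `a_k = M^{-n_k}` and witness renormalisations that are time-reflection symmetric
  and polynomially bounded in the cutoff.  It is CLOSED by the tree theorem
  `…LatticeGapOnTrajectory.OrbitKantorovichFiniteSize.Transfer.hasMassGap_of_torusOSGapSlack`
  (`gapToContinuumOS_holds` below, one line).  Why these side conditions are exactly the cure of the three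
  defects of the typed crux: OS currency (variance-normalised, all bounded `X`, uniform threshold `k₀`)
  removes D2 (product species) and D3 (per-pair sup-norm constants); the slack `ε_k‖X‖∞²` with
  `ε_k a_k^{-p} → 0` and `HasPolynomialRenormalisations` is the honest form of the thermal (wrap-around)
  term on a time-periodic torus; `IsReflectionSymmetric` makes the reflected smeared field the smeared
  field of the reflected species with the SAME constants; `M`-adic spacings let lattice times `s·a_k` hit a
  dense set of physical times exactly (no equicontinuity step).  `0 < Δ` and `0 ≤ β_k` are not needed by
  the transfer (reflection positivity is used upstream, to PRODUCE `TorusOSGapSlack`, not here).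
* `OSLegsAtWeakCouplingOS` — the OS-legs crux `OSLegsAtWeakCouplingC` (stmt-QuantumFields-16207) verbatim
  with the final `∃ Δ > 0, HasLatticeMassGap r sch Δ` extended by the R4 side conditions (the scheme is
  EXISTENTIAL there, so `M`-adic spacings / symmetric polynomial renormalisations / the slack are choices of
  the constructor, and `TorusOSGapSlack` is what a volume-uniform transfer-matrix gap at `β_k ≥ 0` gives).
* `closes_restatedOS` — the route's deciding theorem re-proved with these two changes (four cruxes;
  `GapToContinuum` discharged by the tree), and `osLegsAtWeakCouplingC_of_OS` (drop the new conjunct).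

Nothing here is proposed to the tree; it is evidence attached to the crux item.  Choice between R1 and R4
is the planner's: R1 is the weakest hypothesis that transfers (necessary and sufficient modulo OS
reconstruction); R4 is stronger but is stated on the lattice side alone (no smeared fields, no test
functions) and is the natural OUTPUT format of a transfer-matrix spectral gap, i.e. of the IR items.
-/

namespace Summit.QuantumFields.YangMills.Cruxes.GapToContinuum.LeadC1

open Filter Topology
open Literature.MathematicalPhysics.QuantumFieldTheory
open Summit.QuantumFields.YangMills.Theses.LangevinControlUV
open Summit.QuantumFields.YangMills.Cruxes.LatticeGapOnTrajectory.OrbitKantorovichFiniteSize.Transfer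

/-- **R4 (restated crux, OS currency on the own tori).** For `M`-adic spacings, reflection-symmetric
polynomially bounded witness renormalisations and an `a_k`-superpolynomially small slack `ε`, the torus
OS gap with slack `TorusOSGapSlack r sch Δ ε` and `IsYangMillsFor r sch T` give the full-spectrum gap
`T.HasMassGap Δ` (same rate; no `0 < Δ`, no sign condition on `β_k` needed for the transfer). -/
def GapToContinuumOS : Prop :=
  ∀ (G : Type) [Group G] [TopologicalSpace G] [IsTopologicalGroup G] [CompactSpace G]
    [MeasurableSpace G] [BorelSpace G] (r : LatticeRep G) (sch : SpeciesScheme (YMSpecies G))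
    (T : OSData (YMSpecies G) 4) (Δ : ℝ) (M : ℕ) (nk : ℕ → ℕ) (ε : ℕ → ℝ), 2 ≤ M →
    (∀ k, sch.a k = ((M : ℝ) ^ nk k)⁻¹) →
    (∀ p : ℕ, Tendsto (fun k => ε k * ((sch.a k)⁻¹) ^ p) atTop (𝓝 0)) →
    TorusOSGapSlack r sch Δ ε → sch.IsReflectionSymmetric → HasPolynomialRenormalisations sch →
      IsYangMillsFor r sch T → T.HasMassGap Δ

/-- R4 is a theorem of the tree (sibling crux LatticeGapOnTrajectory, `hasMassGap_of_torusOSGapSlack`). -/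
theorem gapToContinuumOS_holds : GapToContinuumOS :=
  fun _G _ _ _ _ _ _ r _sch _T _Δ _M _nk _ε hM hshape hε hgap hsym hpoly hYM =>
    hasMassGap_of_torusOSGapSlack r hM hshape hε hgap hsym hpoly hYM

/-- **Sanity link R4 ⇐ R1's currency is not claimed; but the idealised slack-free gap is an instance**:
`TorusOSGap r sch Δ` (zero slack) also closes, with no growth condition on the renormalisations. -/
theorem hasMassGap_of_torusOSGap_noSlack {G : Type} [Group G] [TopologicalSpace G] [IsTopologicalGroup G]
    [CompactSpace G] [MeasurableSpace G] [BorelSpace G] (r : LatticeRep G)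
    {sch : SpeciesScheme (YMSpecies G)} {T : OSData (YMSpecies G) 4} {Δ : ℝ} {M : ℕ} {nk : ℕ → ℕ}
    (hM : 2 ≤ M) (hshape : ∀ k, sch.a k = ((M : ℝ) ^ nk k)⁻¹) (hgap : TorusOSGap r sch Δ)
    (hsym : sch.IsReflectionSymmetric) (hYM : IsYangMillsFor r sch T) : T.HasMassGap Δ :=
  hasMassGap_of_torusOSGap r hM hshape hgap hsym hYM

/-- **R4-legs (restated OS legs).** Verbatim `OSLegsAtWeakCouplingC` (stmt-QuantumFields-16207) with the
conclusion's last conjunct `∃ Δ > 0, HasLatticeMassGap r sch Δ` extended by the R4 side conditions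
`∧ ∃ M nk ε, 2 ≤ M ∧ (∀ k, sch.a k = (M ^ nk k)⁻¹) ∧ (∀ p, ε_k a_k^{-p} → 0) ∧ TorusOSGapSlack r sch Δ ε ∧
sch.IsReflectionSymmetric ∧ HasPolynomialRenormalisations sch`. -/
def OSLegsAtWeakCouplingOS : Prop :=
  open Literature.MathematicalPhysics.QuantumFieldTheory in ∀ (G : Type) [Group G] [TopologicalSpace G] [IsTopologicalGroup G] [CompactSpace G], IsCompactSimpleLieGroup G → letI : MeasurableSpace G := borel G; haveI : BorelSpace G := ⟨rfl⟩; ∀ (r : LatticeRep G), ∀ (a : ℝ → ℝ), Continuous a → (∃ (Γ : ℝ → ℝ) (β₀ ℓ₀ c C : ℝ), 0 < ℓ₀ ∧ 0 < c ∧ (∀ β, 0 < a β) ∧ Filter.Tendsto a Filter.atTop (nhds 0) ∧ (∀ s : ℝ, 0 < s → s ≤ ℓ₀ → 0 < Γ s ∧ Γ s ≤ 1) ∧ ∀ (L : ℕ) [NeZero L] (β : ℝ), β₀ ≤ β → (L : ℝ) * a β ≤ ℓ₀ → let P : (Fin 4 → ZMod L) → Fin 4 → Fin 4 → GaugeConfig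 4 L G → ℝ := fun x i j U => (r.N : ℝ) - (r.ρ (plaquetteHolonomy U x i j)).trace.re; let E : (GaugeConfig 4 L G → ℝ) → ℝ := fun F => wilsonExpectation (d := 4) (L := L) r.ρ β F; let cov : (GaugeConfig 4 L G → ℝ) → (GaugeConfig 4 L G → ℝ) → ℝ := fun F F' => E (fun U => F U * F' U) - E F * E F'; let dist : (Fin 4 → ZMod L) → (Fin 4 → ZMod L) → ℝ := fun x y => Real.sqrt (∑ k : Fin 4, (((x k - y k).valMinAbs : ℤ) : ℝ) ^ 2); (∀ n : ℕ, 1 ≤ n → 8 * n ≤ L → c * Γ ((n : ℝ) * a β) ≤ (n : ℝ) ^ 8 * cov (P 0 0 1) (P (Pi.single (2 : Fin 4) ((n : ℕ) : ZMod L)) 0 1) ∧ (n : ℝ) ^ 8 * cov (P 0 0 1) (P (Pi.single (2 : Fin 4) ((n : ℕ) : ZMod L)) 0 1) ≤ C * Γ ((n : ℝ) * a β)) ∧ (∀ (x y : Fin 4 → ZMod L) (i j i' j' : Fin 4), x ≠ y → i ≠ j → i' ≠ j' → |cov (P x i j) (P y i' j')| * dist x y ^ 8 ≤ C * Γ (dist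 x y * a β))) → (∃ (Γ₃ : ℝ → ℝ) (β₁ ℓ₁ c₃ : ℝ), 0 < ℓ₁ ∧ 0 < c₃ ∧ (∀ s : ℝ, 0 < s → s ≤ ℓ₁ → 0 < Γ₃ s) ∧ ∀ (L : ℕ) [NeZero L] (β : ℝ), β₁ ≤ β → (L : ℝ) * a β ≤ ℓ₁ → let P : (Fin 4 → ZMod L) → Fin 4 → Fin 4 → GaugeConfig 4 L G → ℝ := fun x i j U => (r.N : ℝ) - (r.ρ (plaquetteHolonomy U x i j)).trace.re; let E : (GaugeConfig 4 L G → ℝ) → ℝ := fun F => wilsonExpectation (d := 4) (L := L) r.ρ β F; let cov : (GaugeConfig 4 L G → ℝ) → (GaugeConfig 4 L G → ℝ) → ℝ := fun F F' => E (fun U => F U * F' U) - E F * E F'; ∀ n : ℕ, 1 ≤ n → 8 * n ≤ L → c₃ * Γ₃ ((n : ℝ) * a β) ≤ (n : ℝ) ^ 12 * |E (fun U => P 0 0 1 U * P (Pi.single (2 : Fin 4) ((n : ℕ) : ZMod L)) 0 1 U * P (Pi.single (3 : Fin 4) ((n : ℕ) : ZMod L)) 0 1 U) - E (P 0 0 1)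 * cov (P (Pi.single (2 : Fin 4) ((n : ℕ) : ZMod L)) 0 1) (P (Pi.single (3 : Fin 4) ((n : ℕ) : ZMod L)) 0 1) - E (P (Pi.single (2 : Fin 4) ((n : ℕ) : ZMod L)) 0 1) * cov (P 0 0 1) (P (Pi.single (3 : Fin 4) ((n : ℕ) : ZMod L)) 0 1) - E (P (Pi.single (3 : Fin 4) ((n : ℕ) : ZMod L)) 0 1) * cov (P 0 0 1) (P (Pi.single (2 : Fin 4) ((n : ℕ) : ZMod L)) 0 1) - E (P 0 0 1) * E (P (Pi.single (2 : Fin 4) ((n : ℕ) : ZMod L)) 0 1) * E (P (Pi.single (3 : Fin 4) ((n : ℕ) : ZMod L)) 0 1)|) → (∃ (c₁ β₂ : ℝ) (S₁ : ℝ → ℕ), 0 < c₁ ∧ ∀ A B : YMSpecies G, ∃ C : ℝ, ∀ β : ℝ, β₂ ≤ β → ∀ S n : ℕ, S₁ β ≤ S → n ≤ S → |latticeConnectedCorr r.ρ β (2 * S + 1) A.F B.F n| ≤ C * Real.exp (-(c₁ * a β * n))) → ∃ (sch : SpeciesScheme (YMSpecies G)) (T : OSData (YMSpecies G) 4), (∀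 k, sch.a k = a (sch.β k)) ∧ sch.HasWeakCouplingLimit ∧ IsYangMillsFor r sch T ∧ T.IsNontrivial r.curvature ∧ T.IsNonGaussian r.curvature ∧ ∃ Δ > 0, HasLatticeMassGap r sch Δ ∧ ∃ (M : ℕ) (nk : ℕ → ℕ) (ε : ℕ → ℝ), 2 ≤ M ∧ (∀ k, sch.a k = ((M : ℝ) ^ nk k)⁻¹) ∧ (∀ p : ℕ, Filter.Tendsto (fun k => ε k * ((sch.a k)⁻¹) ^ p) Filter.atTop (nhds 0)) ∧ TorusOSGapSlack r sch Δ ε ∧ sch.IsReflectionSymmetric ∧ HasPolynomialRenormalisations sch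


/-- **The deciding theorem under re-type R4**: the same proof as the route's `closes`, with the transfer
`GapToContinuum` replaced by the tree theorem `hasMassGap_of_torusOSGapSlack`. -/
theorem closes_restatedOS (hUV : FemtoCurvatureTwoPointC) (hSkew : FemtoCurvatureSkewnessC)
    (hIR : LatticeGapInUVUnitsC) (hOS : OSLegsAtWeakCouplingOS) : YangMills := by
  intro G _ _ _ _ hG
  letI : MeasurableSpace G := borel G
  haveI : BorelSpace G := ⟨rfl⟩
  obtain ⟨r⟩ := hG.2
  obtain ⟨a, ha, hPa, hSk⟩ := hSkew G hG r (hUV G hG r)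
  have hCl := hIR G hG r a ha hPa
  obtain ⟨sch, T, _, hW, hYM, hNT, hNG, Δ, hΔ, hlat, M, nk, ε, hM, hshape, hε, hgap, hsym, hpoly⟩ :=
    hOS G hG r a ha hPa hSk hCl
  exact ⟨r, sch, T, hW, hYM, hNT, hNG, Δ, hΔ,
    hasMassGap_of_torusOSGapSlack r hM hshape hε hgap hsym hpoly hYM, hlat⟩

/-- The restated OS legs imply the typed OS legs (drop the new conjunct). -/
theorem osLegsAtWeakCouplingC_of_OS (h : OSLegsAtWeakCouplingOS) : OSLegsAtWeakCouplingC := by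
  intro G _ _ _ _ hG r a ha hP hSk hCl
  obtain ⟨sch, T, hsch, hW, hYM, hNT, hNG, Δ, hΔ, hlat, _⟩ := h G hG r a ha hP hSk hCl
  exact ⟨sch, T, hsch, hW, hYM, hNT, hNG, Δ, hΔ, hlat⟩

end Summit.QuantumFields.YangMills.Cruxes.GapToContinuum.LeadC1
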